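import Literature.Geometry.ComplexAnalytic.PhamBrieskornFibreSymmetries
import HarnessLib

/-!
# Milnor's join deformation does not increase the coordinates' moduli: the Milnor fibre cut by any
# coordinatewise-monotone region containing the join still retracts onto the join (local = global Milnor fibre)

Layer `Literature/Geometry/ComplexAnalytic`; theorems only (no definition, no named fact). Written by the prover seat
`hodge-nonav-prover-Ax` (g10) for the programme "localisation of the nodal meridian monodromy" (crux K1 of the route
`Summits/HodgeConjecture/HodgeConjecture/Theses/CyclicUnitaryPowers.lean`).

Milnor, *Singular points of complex hypersurfaces* §9, Lemma 9.2 (Pham): the join `J = Ω_{a₁} * ⋯ * Ω_{a_m}` is a strong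
deformation retract of the affine fibre `F = {Σ zᵢ^{aᵢ} = 1}` (tree: `PhamBrieskornJoin`, the two stages `stepOne`,
`stepTwo`). Both stages multiply each coordinate `zᵢ` by a complex number of modulus `≤ 1` (`zᵢ · σ^{1/aᵢ}` with
`|σ| ≤ 1`, resp. `zᵢ · t^{1/aᵢ}` with `0 ≤ t ≤ 1`). Consequently:

* `norm_stepOneFun_apply_le`, `norm_stepTwoFun_apply_le` — `‖H(s, z)ᵢ‖ ≤ ‖zᵢ‖` for both stages, `s ∈ [0, 1]`;
* for any region `E ⊆ ℂ^ι` which is DOWNWARD CLOSED FOR THE COORDINATE MODULI (`w ∈ E` whenever `‖wᵢ‖ ≤ ‖zᵢ‖` for all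
  `i` and `z ∈ E`: balls, polydiscs, the weighted ellipsoids `{Σ λᵢ‖zᵢ‖² < C}` — `mem_of_sum_mul_norm_sq_lt`), both stages
  preserve `F ∩ E`, so `F_ℝ ∩ E` is a strong deformation retract of `F ∩ E` and `J ∩ E` of `F_ℝ ∩ E`
  (`realFibre_inter_isStrongDeformationRetractOf`, `join_inter_isStrongDeformationRetractOf`); if `J ⊆ E` then **`J` is a
  strong deformation retract of `F ∩ E`** (`join_isStrongDeformationRetractOf_fibre_inter`);
* hence **the inclusion `F ∩ E ↪ F` induces isomorphisms on singular homology** (`isIso_map_inclusion_fibre_inter`,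
  `bijective_map_inclusion_fibre_inter`) — two-out-of-three with the inclusions of `J`;
* such regions are stable under the rotations of the last coordinate by roots of unity (`rotateFun_mem_iff`), and the
  rotation of `F` restricts to a self-homeomorphism of `F ∩ E` commuting with the inclusion
  (`exists_rotate_fibre_inter`).

Use (Milnor §9 Lemma 9.4 / AGZV II §2.3: the LOCAL Milnor fibre `{P = ε} ∩ B_r` of a quasi-homogeneous `P` versus the
global affine fibre `{P = 1}`): after the weighted rescaling `zᵢ ↦ ε^{-1/aᵢ} zᵢ`, the local fibre is `F ∩ E` for a
weighted ellipsoid `E`, which contains `J` (where all `‖zᵢ‖ ≤ 1`) as soon as `ε` is small against `r`; so the local and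
global Milnor fibres of `Σ zᵢ^{aᵢ}` have the same homology, compatibly with the monodromy rotation — the form in which
the tree's computation of `H₂({z₀² + z₁² + z₂^p = 1}; ℚ)` (`PhamBrieskornCyclicNode*`) is fed to the ball piece of a
geometric monodromy (`PhamBrieskornCyclicNodeLocalisationHomotopy`).

## References

* [Milnor1968] J. Milnor, Singular Points of Complex Hypersurfaces, Ann. of Math. Studies 61 (1968), §9 Lemma 9.2 and
  its proof (pp. 76–77), Lemma 9.4, Thm. 9.1.
* [ArnoldGuseinzadeVarchenko2012] V. I. Arnold, S. M. Gusein-Zade, A. N. Varchenko, Singularities of Differentiable Maps,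
  Vol. 2, Part I §2.3 (quasi-homogeneous singularities: local and global Milnor fibre).
* [HatcherAT2002] A. Hatcher, Algebraic Topology, Ch. 0 p. 3, §2.1 Cor. 2.11.
-/

noncomputable section

open Complex ContinuousMap Set Filter CategoryTheory
open Literature.AlgebraicTopology.SingularHomology Literature.AlgebraicTopology.Homotopy
open scoped unitInterval Topology

namespace Literature.Geometry.ComplexAnalytic

namespace PhamBrieskorn

/-! ### Both stages of Milnor's deformation do not increase the coordinate moduli -/

section Norms

variable {ι : Type} [Fintype ι] {a : ι → ℕ}

omit [Fintype ι] in
/-- **Stage one does not increase `‖zᵢ‖`**: `zᵢ` is multiplied by `σ^{1/aᵢ}` with `|σ| ≤ 1`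
(`norm_segFactor_le_one`, `norm_root_le_one`). [cite: Milnor1968, §9 proof of Lemma 9.2 (p. 76)] -/
theorem norm_stepOneFun_apply_le {s : ℝ} (hs₀ : 0 ≤ s) (hs₁ : s ≤ 1) (z : ι → ℂ) (i : ι) :
    ‖stepOneFun a s z i‖ ≤ ‖z i‖ := by
  change ‖z i * root (a i) (segFactor s (z i ^ a i))‖ ≤ ‖z i‖
  rw [norm_mul]
  exact mul_le_of_le_one_right (norm_nonneg _) (norm_root_le_one (norm_segFactor_le_one hs₀ hs₁ _))

/-- **Stage two does not increase `‖zᵢ‖`** (on `[0,1] × F`): `zᵢ` is multiplied by `t^{1/aᵢ}` with `0 ≤ t ≤ 1`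
(`stepTwoFactor_nonneg`, `stepTwoFactor_le_one`). [cite: Milnor1968, §9 proof of Lemma 9.2 (p. 77)] -/
theorem norm_stepTwoFun_apply_le {s : ℝ} (hs₀ : 0 ≤ s) (hs₁ : s ≤ 1) {z : ι → ℂ} (hz : z ∈ fibre a) (i : ι) :
    ‖stepTwoFun a s z i‖ ≤ ‖z i‖ := by
  change ‖z i * root (a i) ((stepTwoFactor a s z i : ℝ) : ℂ)‖ ≤ ‖z i‖
  rw [norm_mul]
  refine mul_le_of_le_one_right (norm_nonneg _) (norm_root_le_one ?_)
  rw [Complex.norm_real, Real.norm_eq_abs, abs_of_nonneg (stepTwoFactor_nonneg hs₀ hs₁ hz i)]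
  exact stepTwoFactor_le_one hs₀ hz i

omit [Fintype ι] in
/-- A region downward closed for the coordinate moduli contains, with `z`, every image `H(s, z)` of stage one.
[cite: Milnor1968, §9 proof of Lemma 9.2 (p. 76)] -/
theorem stepOneFun_mem_of_norm_le {E : Set (ι → ℂ)} (hE : ∀ z ∈ E, ∀ w : ι → ℂ, (∀ i, ‖w i‖ ≤ ‖z i‖) → w ∈ E)
    {s : ℝ} (hs₀ : 0 ≤ s) (hs₁ : s ≤ 1) {z : ι → ℂ} (hz : z ∈ E) : stepOneFun a s z ∈ E :=
  hE z hz _ fun i => norm_stepOneFun_apply_le hs₀ hs₁ z i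

/-- A region downward closed for the coordinate moduli contains, with `z ∈ F`, every image `H(s, z)` of stage two.
[cite: Milnor1968, §9 proof of Lemma 9.2 (p. 77)] -/
theorem stepTwoFun_mem_of_norm_le {E : Set (ι → ℂ)} (hE : ∀ z ∈ E, ∀ w : ι → ℂ, (∀ i, ‖w i‖ ≤ ‖z i‖) → w ∈ E)
    {s : ℝ} (hs₀ : 0 ≤ s) (hs₁ : s ≤ 1) {z : ι → ℂ} (hzF : z ∈ fibre a) (hz : z ∈ E) : stepTwoFun a s z ∈ E :=
  hE z hz _ fun i => norm_stepTwoFun_apply_le hs₀ hs₁ hzF i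

omit [Fintype ι] in
/-- **Weighted ellipsoids are downward closed for the coordinate moduli**: if `Σ λᵢ ‖zᵢ‖² < C` with `λᵢ ≥ 0` and
`‖wᵢ‖ ≤ ‖zᵢ‖` for all `i`, then `Σ λᵢ ‖wᵢ‖² < C` (the regions `δ_{1/ε}(B_r)` of the local Milnor fibre).
[cite: ArnoldGuseinzadeVarchenko2012, Part I §2.3] -/
theorem mem_of_sum_mul_norm_sq_lt [Fintype ι] {lam : ι → ℝ} (hlam : ∀ i, 0 ≤ lam i) (C : ℝ) :
    ∀ z ∈ {z : ι → ℂ | ∑ i, lam i * ‖z i‖ ^ 2 < C}, ∀ w : ι → ℂ, (∀ i, ‖w i‖ ≤ ‖z i‖) →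
      w ∈ {z : ι → ℂ | ∑ i, lam i * ‖z i‖ ^ 2 < C} := by
  intro z (hz : ∑ i, lam i * ‖z i‖ ^ 2 < C) w hw
  show ∑ i, lam i * ‖w i‖ ^ 2 < C
  refine lt_of_le_of_lt (Finset.sum_le_sum fun i _ => ?_) hz
  exact mul_le_mul_of_nonneg_left (pow_le_pow_left₀ (norm_nonneg _) (hw i) 2) (hlam i)

omit [Fintype ι] in
/-- On the join all coordinates have modulus `≤ 1` (`zᵢ^{aᵢ} = tᵢ ∈ [0, 1]`, `Σ tᵢ = 1`), for exponents `aᵢ ≠ 0`.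
[cite: Milnor1968, §9 p. 76] -/
theorem norm_apply_le_one_of_mem_join [Fintype ι] (ha : ∀ i, a i ≠ 0) {z : ι → ℂ} (hz : z ∈ join a) (i : ι) :
    ‖z i‖ ≤ 1 := by
  have hre : ∀ j, 0 ≤ (z j ^ a j).re := fun j => (hz.2 j).2
  have hsum : ∑ j, (z j ^ a j).re = 1 := sum_re_pow_eq_one (join_subset_fibre hz)
  have hle : (z i ^ a i).re ≤ 1 := by
    rw [← hsum]
    exact Finset.single_le_sum (fun j _ => hre j) (Finset.mem_univ i)
  have hnorm : ‖z i ^ a i‖ = (z i ^ a i).re := by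
    have him : (z i ^ a i).im = 0 := (hz.2 i).1
    rw [← Complex.re_add_im (z i ^ a i), him, Complex.ofReal_zero, zero_mul, add_zero, Complex.norm_real,
      Real.norm_eq_abs, abs_of_nonneg (hre i), Complex.ofReal_re]
  have h1 : ‖z i‖ ^ a i ≤ 1 := by rw [← norm_pow, hnorm]; exact hle
  exact (pow_le_one_iff_of_nonneg (norm_nonneg _) (ha i)).1 h1

omit [Fintype ι] in
/-- The join lies in the weighted ellipsoid `{Σ λᵢ ‖zᵢ‖² < C}` as soon as `Σ λᵢ < C` (`λᵢ ≥ 0`).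
[cite: Milnor1968, §9 p. 76] -/
theorem join_subset_of_sum_lt [Fintype ι] (ha : ∀ i, a i ≠ 0) {lam : ι → ℝ} (hlam : ∀ i, 0 ≤ lam i) {C : ℝ}
    (hC : ∑ i, lam i < C) : join a ⊆ {z : ι → ℂ | ∑ i, lam i * ‖z i‖ ^ 2 < C} := by
  intro z hz
  show ∑ i, lam i * ‖z i‖ ^ 2 < C
  refine lt_of_le_of_lt (Finset.sum_le_sum fun i _ => ?_) hC
  have h1 : ‖z i‖ ^ 2 ≤ 1 := pow_le_one₀ (norm_nonneg _) (norm_apply_le_one_of_mem_join ha hz i)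
  calc lam i * ‖z i‖ ^ 2 ≤ lam i * 1 := mul_le_mul_of_nonneg_left h1 (hlam i)
    _ = lam i := mul_one _

end Norms

/-! ### The cut fibre `F ∩ E` retracts onto the join -/

section Retract

variable {ι : Type} [Fintype ι] (a : ι → ℕ) {E : Set (ι → ℂ)}

/-- **Stage one on the cut fibre**: `F_ℝ ∩ E` is a strong deformation retract of `F ∩ E` (Milnor's first deformation
preserves `E`). [cite: Milnor1968, §9 proof of Lemma 9.2 (p. 76)] -/
theorem realFibre_inter_isStrongDeformationRetractOf (ha : ∀ i, a i ≠ 0)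
    (hE : ∀ z ∈ E, ∀ w : ι → ℂ, (∀ i, ‖w i‖ ≤ ‖z i‖) → w ∈ E) :
    IsStrongDeformationRetractOf (realFibre a ∩ E) (fibre a ∩ E) := by
  refine ⟨⟨fun p => ⟨stepOneFun a p.1 p.2, stepOneFun_mem_fibre ha _ p.2.2.1,
      stepOneFun_mem_of_norm_le hE p.1.2.1 p.1.2.2 p.2.2.2⟩, ?_⟩, fun z => ?_, fun z => ?_, fun s z hz => ?_⟩
  · exact ((continuous_stepOneFun ha).comp
      (continuous_fst.prodMk (continuous_subtype_val.comp continuous_snd))).subtype_mk _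
  · exact Subtype.ext (stepOneFun_zero _)
  · exact ⟨stepOneFun_one_mem_realFibre ha z.2.1, stepOneFun_mem_of_norm_le hE zero_le_one le_rfl z.2.2⟩
  · exact Subtype.ext (stepOneFun_of_mem_realFibre s hz.1)

/-- **Stage two on the cut fibre**: `J ∩ E` is a strong deformation retract of `F_ℝ ∩ E` (the normalised second
deformation preserves `E`). [cite: Milnor1968, §9 proof of Lemma 9.2 (p. 77)] -/
theorem join_inter_isStrongDeformationRetractOf (ha : ∀ i, a i ≠ 0)
    (hE : ∀ z ∈ E, ∀ w : ι → ℂ, (∀ i, ‖w i‖ ≤ ‖z i‖) → w ∈ E) :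
    IsStrongDeformationRetractOf (join a ∩ E) (realFibre a ∩ E) := by
  -- the inclusion `[0,1] × (F_ℝ ∩ E) → [0,1] × F_ℝ`, then Milnor's `stepTwo`
  let j : I × ↥(realFibre a ∩ E) → I × realFibre a := fun p => (p.1, ⟨(p.2 : ι → ℂ), p.2.2.1⟩)
  have hj : Continuous j :=
    continuous_fst.prodMk ((continuous_subtype_val.comp continuous_snd).subtype_mk _)
  refine ⟨⟨fun p => ⟨stepTwoFun a p.1 p.2, (stepTwo a ha (j p)).2,
      stepTwoFun_mem_of_norm_le hE p.1.2.1 p.1.2.2 (realFibre_subset_fibre p.2.2.1) p.2.2.2⟩, ?_⟩,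
    fun z => ?_, fun z => ?_, fun s z hz => ?_⟩
  · exact (continuous_subtype_val.comp ((stepTwo a ha).continuous.comp hj)).subtype_mk _
  · exact Subtype.ext (stepTwoFun_zero _)
  · exact ⟨stepTwoFun_one_mem_join ha z.2.1,
      stepTwoFun_mem_of_norm_le hE zero_le_one le_rfl (realFibre_subset_fibre z.2.1) z.2.2⟩
  · exact Subtype.ext (stepTwoFun_of_mem_join ha s hz.1)

/-- **The join is a strong deformation retract of the cut fibre `F ∩ E`** for every region `E` downward closed for the
coordinate moduli (Lemma 9.2 run inside `E`: "points of `J` remain fixed throughout the deformation" and no modulus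
increases; in the tree's notion only `J ∩ (F ∩ E)` matters, so `J ⊆ E` is not even needed here).
[cite: Milnor1968, §9 Lemma 9.2 (pp. 76–77)] -/
theorem join_isStrongDeformationRetractOf_fibre_inter (ha : ∀ i, a i ≠ 0)
    (hE : ∀ z ∈ E, ∀ w : ι → ℂ, (∀ i, ‖w i‖ ≤ ‖z i‖) → w ∈ E) :
    IsStrongDeformationRetractOf (join a) (fibre a ∩ E) := by
  have h := (realFibre_inter_isStrongDeformationRetractOf a ha hE).trans
    (join_inter_isStrongDeformationRetractOf a ha hE)
    (Set.inter_subset_inter_left _ realFibre_subset_fibre) (Set.inter_subset_inter_left _ join_subset_realFibre)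
  exact h.congr_right (fun x hx => hx.1.1) (fun x hx => ⟨hx.1, hx.2.2⟩)

/-- `J ⊆ F ∩ E` when `J ⊆ E`. [cite: Milnor1968, §9 p. 76] -/
theorem join_subset_fibre_inter (hJE : join a ⊆ E) : join a ⊆ fibre a ∩ E :=
  fun _ hz => ⟨join_subset_fibre hz, hJE hz⟩

/-- **The inclusion of the cut fibre `F ∩ E ↪ F` induces isomorphisms on singular homology** (both retract onto the
join; two-out-of-three for `J ↪ F ∩ E ↪ F`, Hatcher Cor. 2.11). [cite: Milnor1968, §9 Lemma 9.2 (pp. 76–77)]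
[cite: HatcherAT2002, §2.1 Cor. 2.11] -/
theorem isIso_map_inclusion_fibre_inter (R M : Type) [CommRing R] [AddCommGroup M] [Module R M]
    (ha : ∀ i, a i ≠ 0) (hE : ∀ z ∈ E, ∀ w : ι → ℂ, (∀ i, ‖w i‖ ≤ ‖z i‖) → w ∈ E) (hJE : join a ⊆ E) (n : ℕ) :
    IsIso (singularHomology.map R M
      (⟨Set.inclusion (Set.inter_subset_left : fibre a ∩ E ⊆ fibre a), continuous_inclusion _⟩ :
        C(↥(fibre a ∩ E), fibre a)) n) := by
  -- the two inclusions of the join are homotopy equivalences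
  obtain ⟨e₁, he₁⟩ := (join_isStrongDeformationRetractOf_fibre_inter a ha hE).exists_homotopyEquiv_inclusion
    (join_subset_fibre_inter a hJE)
  obtain ⟨e, he⟩ := (join_isStrongDeformationRetractOf_fibre a ha).exists_homotopyEquiv_inclusion join_subset_fibre
  let i₁ : C(join a, ↥(fibre a ∩ E)) :=
    ⟨Set.inclusion (join_subset_fibre_inter a hJE), continuous_inclusion _⟩
  let i₂ : C(↥(fibre a ∩ E), fibre a) :=
    ⟨Set.inclusion (Set.inter_subset_left : fibre a ∩ E ⊆ fibre a), continuous_inclusion _⟩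
  let i : C(join a, fibre a) := ⟨Set.inclusion join_subset_fibre, continuous_inclusion _⟩
  have hcomp : i₂.comp i₁ = i := by ext z : 1; exact Subtype.ext rfl
  have h1 : IsIso (singularHomology.map R M i₁ n) := by
    have : singularHomology.map R M i₁ n = (singularHomology.isoOfHomotopyEquiv R M e₁ n).hom := by
      change _ = singularHomology.map R M e₁.toFun n
      rw [he₁]
    rw [this]
    infer_instance
  have h2 : IsIso (singularHomology.map R M i₁ n ≫ singularHomology.map R M i₂ n) := by
    rw [← singularHomology.map_comp, hcomp]
    have : singularHomology.map R M i n = (singularHomology.isoOfHomotopyEquiv R M e n).hom := by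
      change _ = singularHomology.map R M e.toFun n
      rw [he]
    rw [this]
    infer_instance
  exact IsIso.of_isIso_comp_left (singularHomology.map R M i₁ n) (singularHomology.map R M i₂ n)

/-- The induced map of `F ∩ E ↪ F` on singular homology is bijective. [cite: Milnor1968, §9 Lemma 9.2 (pp. 76–77)]
[cite: HatcherAT2002, §2.1 Cor. 2.11] -/
theorem bijective_map_inclusion_fibre_inter (R M : Type) [CommRing R] [AddCommGroup M] [Module R M]
    (ha : ∀ i, a i ≠ 0) (hE : ∀ z ∈ E, ∀ w : ι → ℂ, (∀ i, ‖w i‖ ≤ ‖z i‖) → w ∈ E) (hJE : join a ⊆ E) (n : ℕ) :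
    Function.Bijective (singularHomology.map R M
      (⟨Set.inclusion (Set.inter_subset_left : fibre a ∩ E ⊆ fibre a), continuous_inclusion _⟩ :
        C(↥(fibre a ∩ E), fibre a)) n).hom := by
  haveI := isIso_map_inclusion_fibre_inter a R M ha hE hJE n
  exact (asIso (singularHomology.map R M
      (⟨Set.inclusion (Set.inter_subset_left : fibre a ∩ E ⊆ fibre a), continuous_inclusion _⟩ :
        C(↥(fibre a ∩ E), fibre a)) n)).toLinearEquiv.bijective

end Retract

/-! ### Rotations of the last coordinate preserve the cut fibre -/

section Rotate

variable {n : ℕ} (a : Fin (n + 1) → ℕ) {E : Set (Fin (n + 1) → ℂ)}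

/-- Rotating the last coordinate by a root of unity does not change any modulus.
[cite: Milnor1968, §9 p. 77] -/
theorem norm_rotateFun_apply (ha : ∀ i, a i ≠ 0) {v : ℂ} (hv : v ∈ Omega (a (Fin.last n)))
    (z : Fin (n + 1) → ℂ) (i : Fin (n + 1)) : ‖rotateFun v z i‖ = ‖z i‖ := by
  have hv1 : ‖v‖ = 1 := Complex.norm_eq_one_of_pow_eq_one (mem_Omega.1 hv) (ha _)
  change ‖(Fin.snoc (fun _ : Fin n ↦ (1 : ℂ)) v : Fin (n + 1) → ℂ) i * z i‖ = ‖z i‖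
  rw [norm_mul]
  have h1 : ‖(Fin.snoc (fun _ : Fin n ↦ (1 : ℂ)) v : Fin (n + 1) → ℂ) i‖ = 1 := by
    induction i using Fin.lastCases with
    | last => rw [Fin.snoc_last, hv1]
    | cast j => rw [Fin.snoc_castSucc, norm_one]
  rw [h1, one_mul]

/-- A region downward closed for the coordinate moduli is stable under the rotations of the last coordinate by roots
of unity, in both directions. [cite: Milnor1968, §9 p. 77] -/
theorem rotateFun_mem_iff (ha : ∀ i, a i ≠ 0) (hE : ∀ z ∈ E, ∀ w : Fin (n + 1) → ℂ, (∀ i, ‖w i‖ ≤ ‖z i‖) → w ∈ E)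
    {v : ℂ} (hv : v ∈ Omega (a (Fin.last n))) (z : Fin (n + 1) → ℂ) : rotateFun v z ∈ E ↔ z ∈ E :=
  ⟨fun h => hE _ h z fun i => (norm_rotateFun_apply a ha hv z i).symm.le,
    fun h => hE _ h _ fun i => (norm_rotateFun_apply a ha hv z i).le⟩

/-- **The rotation of the fibre restricts to a self-homeomorphism of the cut fibre `F ∩ E` commuting with the
inclusion** `F ∩ E ↪ F` (existence form; the restriction of `rotateFibre a ha v`). [cite: Milnor1968, §9 p. 77] -/
theorem exists_rotate_fibre_inter (ha : ∀ i, a i ≠ 0)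
    (hE : ∀ z ∈ E, ∀ w : Fin (n + 1) → ℂ, (∀ i, ‖w i‖ ≤ ‖z i‖) → w ∈ E) (v : Omega (a (Fin.last n))) :
    ∃ ρ : ↥(fibre a ∩ E) ≃ₜ ↥(fibre a ∩ E),
      (∀ z : ↥(fibre a ∩ E), ((ρ z : ↥(fibre a ∩ E)) : Fin (n + 1) → ℂ) = rotateFun v z) ∧
      (⟨Set.inclusion (Set.inter_subset_left : fibre a ∩ E ⊆ fibre a), continuous_inclusion _⟩ :
          C(↥(fibre a ∩ E), fibre a)).comp (ρ : C(↥(fibre a ∩ E), ↥(fibre a ∩ E))) =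
        (rotateFibre a ha v : C(fibre a, fibre a)).comp
          ⟨Set.inclusion (Set.inter_subset_left : fibre a ∩ E ⊆ fibre a), continuous_inclusion _⟩ := by
  have hne : (v : ℂ) ≠ 0 := ne_zero_of_mem_Omega (ha _) v.2
  let ρ : ↥(fibre a ∩ E) ≃ₜ ↥(fibre a ∩ E) :=
    { toFun := fun z => ⟨rotateFun v z, rotateFun_mem_fibre a v.2 z.2.1, (rotateFun_mem_iff a ha hE v.2 _).2 z.2.2⟩
      invFun := fun z => ⟨rotateFun (v : ℂ)⁻¹ z, rotateFun_mem_fibre a (inv_mem_Omega v.2) z.2.1,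
        (rotateFun_mem_iff a ha hE (inv_mem_Omega v.2) _).2 z.2.2⟩
      left_inv := fun z => Subtype.ext (by
        change rotateFun (v : ℂ)⁻¹ (rotateFun v (z : Fin (n + 1) → ℂ)) = (z : Fin (n + 1) → ℂ)
        rw [rotateFun_rotateFun, inv_mul_cancel₀ hne, rotateFun_one])
      right_inv := fun z => Subtype.ext (by
        change rotateFun v (rotateFun (v : ℂ)⁻¹ (z : Fin (n + 1) → ℂ)) = (z : Fin (n + 1) → ℂ)
        rw [rotateFun_rotateFun, mul_inv_cancel₀ hne, rotateFun_one])
      continuous_toFun := ((continuous_rotateFun v).comp continuous_subtype_val).subtype_mk _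
      continuous_invFun := ((continuous_rotateFun _).comp continuous_subtype_val).subtype_mk _ }
  refine ⟨ρ, fun z => rfl, ?_⟩
  ext z : 1
  exact Subtype.ext rfl

end Rotate

end PhamBrieskorn

end Literature.Geometry.ComplexAnalytic

end
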